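import Summits.HodgeConjecture.HodgeConjecture.Theorems.HodgeLocusCensusCubicTypes
import Summits.HodgeConjecture.HodgeConjecture.Theorems.HodgeLocusCensusSecondComponents
import HarnessLib

/-!
# HodgeLocusCensusCubicRank8 — a valid cubic core certificate decides the rank of Movasati's matrix of a signed plane sum on the Fermat CUBIC EIGHTFOLD (cell pub-hlocus, LEAD gen 5, (T39))
HONEST FRAMING: certified instances and evidence bearing on the general Hodge conjecture; no claim.

MAIN THEOREM `ivhsRankEq3_of_cert8`: for a class L of coordinate planes of X³_8 twisted on the last three pairs, a certificate Ψ with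
`Ψ.valid L = true` and a mode enumeration (modeK, off) over the 10 d = 3 types of `HodgeLocusCensusCubicTypes` with the structure facts H1–H3
give `IvhsRankEq 8 3 r (cplaneList8 L)`, r = Σ_types r_{shape} — the d = 3 transcription of `HodgeLocusCensusPlaneSumRank8.ivhsRankEq_of_cert8`
(pair sums 1 instead of 2, ζ a primitive sixth root with ζ² = ζ − 1 from `primRoot6_facts`, tails on the FIRST 2 pair(s): factors ζ^{Σ i_tail},
ζ^{Σ (j_tail + 1)}). UPPER bound M = U·V through K^r; LOWER bound: the minor on the pivot rows (0, σ_tails ; h, σ_heads − h) and pivot columns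
(0, 1 − σ_tails ; g, 1 − σ_heads − g) is (lower triangular, positive-integer diagonal)·(upper triangular, nonzero diagonal) in mode order.
-/

namespace Summit.HodgeConjecture.HodgeConjecture.HodgeLocus.Census.CubicSum

open TwistCells GrSection

section cert

variable {K : Type*} [Field K] (ζ : K) (L : List (ℤ × ℕ × ℕ × ℕ)) (Ψ : CubicCert) {r : ℕ} (modeK : Fin r → Fin 10) (off : Fin 10 → ℕ)

/-- rows of I_{N} have total degree N = k − 2 = 2. -/
theorem crow_sum8 (i : Fin 10 → ℕ) (hi : i ∈ indexSet 8 3 (8 / 2 * 3 - 8 - 2)) : i 0 + i 1 + i 2 + i 3 + i 4 + i 5 + i 6 + i 7 + i 8 + i 9 = 2 := by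
  have h := (Finset.mem_filter.mp hi).2
  rw [Finset.sum_fin_eq_sum_range] at h
  simp [Finset.sum_range_succ] at h
  omega

/-- left factor: U[i, m] = [type(i) = type(m)] · ζ^{Σ i_tails} · A_{shape}[head(i), ℓ(m)](ζ). -/
noncomputable def CU8 : Matrix (indexSet 8 3 (8 / 2 * 3 - 8 - 2)) (Fin r) K := fun i m =>
  if i.1 0 + i.1 1 = csig8_0 (modeK m) ∧ i.1 2 + i.1 3 = csig8_1 (modeK m) ∧ i.1 4 + i.1 5 = csig8_2 (modeK m) ∧ i.1 6 + i.1 7 = csig8_3 (modeK m) ∧ i.1 8 + i.1 9 = csig8_4 (modeK m) then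
    ζ ^ (i.1 0 + i.1 2) * Z6.eval ζ (Ψ.A (csig8_2 (modeK m)) (csig8_3 (modeK m)) (csig8_4 (modeK m)) (i.1 4) (i.1 6) (i.1 8) (m.1 - off (modeK m))) else 0

/-- right factor: V[m, j] = [type(j) complementary to type(m)] · ζ^{Σ (j_tail + 1)} · B_{shape}[ℓ(m), head(j)](ζ). -/
noncomputable def CV8 : Matrix (Fin r) (indexSet 8 3 3) K := fun m j =>
  if csig8_0 (modeK m) + (j.1 0 + j.1 1) = 1 ∧ csig8_1 (modeK m) + (j.1 2 + j.1 3) = 1 ∧ csig8_2 (modeK m) + (j.1 4 + j.1 5) = 1 ∧ csig8_3 (modeK m) + (j.1 6 + j.1 7) = 1 ∧ csig8_4 (modeK m) + (j.1 8 + j.1 9) = 1 then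
    ζ ^ (j.1 0 + 1 + (j.1 2 + 1)) * Z6.eval ζ (Ψ.B (csig8_2 (modeK m)) (csig8_3 (modeK m)) (csig8_4 (modeK m)) (m.1 - off (modeK m)) (j.1 4) (j.1 6) (j.1 8)) else 0

/-- ENTRY FORMULA of M_δ for δ = cplaneList8 L on the cubic. -/
theorem ivhsMatrix_cplaneList8_apply (h2 : ζ ^ 2 = ζ - 1) (i : indexSet 8 3 (8 / 2 * 3 - 8 - 2)) (j : indexSet 8 3 3) :
    ivhsMatrix 8 3 ζ (cplaneList8 L) i j =
      if i.1 0 + j.1 0 + (i.1 1 + j.1 1) = 1 ∧ i.1 2 + j.1 2 + (i.1 3 + j.1 3) = 1 ∧ i.1 4 + j.1 4 + (i.1 5 + j.1 5) = 1 ∧ i.1 6 + j.1 6 + (i.1 7 + j.1 7) = 1 ∧ i.1 8 + j.1 8 + (i.1 9 + j.1 9) = 1 then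
        ζ ^ (i.1 0 + j.1 0 + 1 + (i.1 2 + j.1 2 + 1)) * Z6.eval ζ (core3 L (i.1 4 + j.1 4) (i.1 6 + j.1 6) (i.1 8 + j.1 8)) else 0 := by
  unfold ivhsMatrix
  rw [periodComb_cplaneList8 ζ h2]

/-- STRUCTURE THEOREM: M_δ = U · V through K^r. -/
theorem ivhsMatrix_cplaneList8_eq_mul (h2 : ζ ^ 2 = ζ - 1) (hV : Ψ.valid L = true)
    (H1 : ∀ m : Fin r, off (modeK m) ≤ m.1 ∧ m.1 < off (modeK m) + crs8 Ψ (modeK m)) (H2 : ∀ k : Fin 10, off k + crs8 Ψ k ≤ r)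
    (H3 : ∀ m : Fin r, ∀ k : Fin 10, off k ≤ m.1 → m.1 < off k + crs8 Ψ k → modeK m = k) :
    ivhsMatrix 8 3 ζ (cplaneList8 L) = CU8 ζ Ψ modeK off * CV8 ζ Ψ modeK off := by
  ext i j
  rw [Matrix.mul_apply, ivhsMatrix_cplaneList8_apply ζ L h2]
  by_cases hex : ∃ k : Fin 10, i.1 0 + i.1 1 = csig8_0 k ∧ i.1 2 + i.1 3 = csig8_1 k ∧ i.1 4 + i.1 5 = csig8_2 k ∧ i.1 6 + i.1 7 = csig8_3 k ∧ i.1 8 + i.1 9 = csig8_4 k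
  · obtain ⟨k₀, q0, q1, q2, q3, q4⟩ := hex
    obtain ⟨l0, l1, l2, l3, l4⟩ := csig_le8 k₀
    have hU : ∀ m : Fin r, modeK m ≠ k₀ → CU8 ζ Ψ modeK off i m = 0 := by
      intro m hm
      unfold CU8
      rw [if_neg]
      intro h
      exact hm (csig_inj8 _ _ (h.1.symm.trans q0) (h.2.1.symm.trans q1) (h.2.2.1.symm.trans q2) (h.2.2.2.1.symm.trans q3) (h.2.2.2.2.symm.trans q4))
    by_cases hc : csig8_0 k₀ + (j.1 0 + j.1 1) = 1 ∧ csig8_1 k₀ + (j.1 2 + j.1 3) = 1 ∧ csig8_2 k₀ + (j.1 4 + j.1 5) = 1 ∧ csig8_3 k₀ + (j.1 6 + j.1 7) = 1 ∧ csig8_4 k₀ + (j.1 8 + j.1 9) = 1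
    · rw [if_pos ⟨by omega, by omega, by omega, by omega, by omega⟩]
      set g : ℕ → K := fun ℓ => ζ ^ (i.1 0 + i.1 2) * Z6.eval ζ (Ψ.A (csig8_2 k₀) (csig8_3 k₀) (csig8_4 k₀) (i.1 4) (i.1 6) (i.1 8) ℓ) *
        (ζ ^ (j.1 0 + 1 + (j.1 2 + 1)) * Z6.eval ζ (Ψ.B (csig8_2 k₀) (csig8_3 k₀) (csig8_4 k₀) ℓ (j.1 4) (j.1 6) (j.1 8))) with hg
      have hterm : ∀ m : Fin r, CU8 ζ Ψ modeK off i m * CV8 ζ Ψ modeK off m j = if modeK m = k₀ then g (m.1 - off k₀) else 0 := by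
        intro m
        by_cases hm : modeK m = k₀
        · rw [if_pos hm, hg]
          unfold CU8 CV8
          rw [hm, if_pos ⟨q0, q1, q2, q3, q4⟩, if_pos hc]
        · rw [if_neg hm, hU m hm, zero_mul]
      rw [Finset.sum_congr rfl fun m _ => hterm m, PlaneSum.sum_modes modeK off (crs8 Ψ) H1 H2 H3 k₀ g,
        ← CubicCert.factor_eq hV (s0 := csig8_2 k₀) (s1 := csig8_3 k₀) (s2 := csig8_4 k₀) (a := i.1 4) (b := i.1 6) (e := i.1 8)
          (a' := j.1 4) (b' := j.1 6) (e' := j.1 8) (by omega) (by omega) (by omega) (by omega) (by omega) (by omega) (by omega) (by omega) (by omega), Z6.eval_rsum, Finset.mul_sum]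
      exact Finset.sum_congr rfl fun ℓ _ => by
        rw [hg, Z6.eval_mul ζ h2]
        ring
    · rw [if_neg fun h => hc ⟨by omega, by omega, by omega, by omega, by omega⟩]
      symm
      refine Finset.sum_eq_zero fun m _ => ?_
      by_cases hm : modeK m = k₀
      · unfold CV8
        rw [hm, if_neg hc, mul_zero]
      · rw [hU m hm, zero_mul]
  · -- a row with some pair sum > 1 (no type): both sides vanish
    have hsum := crow_sum8 i.1 i.2
    have hU : ∀ m : Fin r, CU8 ζ Ψ modeK off i m = 0 := fun m => by
      unfold CU8
      exact if_neg fun h => hex ⟨modeK m, h⟩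
    rw [Finset.sum_eq_zero fun m _ => by rw [hU m, zero_mul], if_neg]
    intro hc
    obtain ⟨c0, c1, c2, c3, c4⟩ := hc
    exact hex (csig_cover8' (i.1 0 + i.1 1) (i.1 2 + i.1 3) (i.1 4 + i.1 5) (i.1 6 + i.1 7) (i.1 8 + i.1 9) (by omega) (by omega) (by omega) (by omega) (by omega)
      (by omega))

/-- UPPER BOUND: rank M_δ ≤ r. -/
theorem crank_le_of_cert8 (h2 : ζ ^ 2 = ζ - 1) (hV : Ψ.valid L = true)
    (H1 : ∀ m : Fin r, off (modeK m) ≤ m.1 ∧ m.1 < off (modeK m) + crs8 Ψ (modeK m)) (H2 : ∀ k : Fin 10, off k + crs8 Ψ k ≤ r)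
    (H3 : ∀ m : Fin r, ∀ k : Fin 10, off k ≤ m.1 → m.1 < off k + crs8 Ψ k → modeK m = k) :
    (ivhsMatrix 8 3 ζ (cplaneList8 L)).rank ≤ r := by
  rw [ivhsMatrix_cplaneList8_eq_mul ζ L Ψ modeK off h2 hV H1 H2 H3]
  exact (Matrix.rank_mul_le_left _ _).trans (by simpa using Matrix.rank_le_card_width (CU8 ζ Ψ modeK off))

/-! ### the witness minor -/

/-- the row (0, σ_tails ; h, σ_heads − h) of type k with head h … -/
def cRow8 (k : Fin 10) (h : ℕ × ℕ × ℕ) : Fin 10 → ℕ :=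
  ![0, csig8_0 k, 0, csig8_1 k, h.1, csig8_2 k - h.1, h.2.1, csig8_3 k - h.2.1, h.2.2, csig8_4 k - h.2.2]
/-- … and the column (0, 1 − σ_tails ; g, 1 − σ_heads − g) of the complementary type with head g. -/
def cCol8 (k : Fin 10) (g : ℕ × ℕ × ℕ) : Fin 10 → ℕ :=
  ![0, 1 - csig8_0 k, 0, 1 - csig8_1 k, g.1, 1 - csig8_2 k - g.1, g.2.1, 1 - csig8_3 k - g.2.1, g.2.2, 1 - csig8_4 k - g.2.2]

/-- the pivot rows lie in I_{k−2} … -/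
theorem cRow8_mem (k : Fin 10) (h : ℕ × ℕ × ℕ) (hb : h.1 ≤ csig8_2 k ∧ h.2.1 ≤ csig8_3 k ∧ h.2.2 ≤ csig8_4 k) :
    cRow8 k h ∈ indexSet 8 3 (8 / 2 * 3 - 8 - 2) := by
  obtain ⟨l0, l1, l2, l3, l4⟩ := csig_le8 k
  have hs := csig_sum8 k
  unfold indexSet
  simp only [Finset.mem_filter, Fintype.mem_piFinset, Finset.mem_range, Fin.forall_fin_succ, Fin.sum_univ_succ]
  simp [cRow8]
  omega

/-- … and the pivot columns in I_3. -/
theorem cCol8_mem (k : Fin 10) (g : ℕ × ℕ × ℕ) (hb : g.1 ≤ 1 - csig8_2 k ∧ g.2.1 ≤ 1 - csig8_3 k ∧ g.2.2 ≤ 1 - csig8_4 k) :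
    cCol8 k g ∈ indexSet 8 3 3 := by
  obtain ⟨l0, l1, l2, l3, l4⟩ := csig_le8 k
  have hs := csig_sum8 k
  unfold indexSet
  simp only [Finset.mem_filter, Fintype.mem_piFinset, Finset.mem_range, Fin.forall_fin_succ, Fin.sum_univ_succ]
  simp [cCol8]
  omega

/-- heads, tails and pair sums of a pivot row … -/
theorem cRow8_val (k : Fin 10) (h : ℕ × ℕ × ℕ) (hb : h.1 ≤ csig8_2 k ∧ h.2.1 ≤ csig8_3 k ∧ h.2.2 ≤ csig8_4 k) :
    cRow8 k h 4 = h.1 ∧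
    cRow8 k h 6 = h.2.1 ∧
    cRow8 k h 8 = h.2.2 ∧
    cRow8 k h 0 = 0 ∧
    cRow8 k h 2 = 0 ∧
    cRow8 k h 0 + cRow8 k h 1 = csig8_0 k ∧
    cRow8 k h 2 + cRow8 k h 3 = csig8_1 k ∧
    cRow8 k h 4 + cRow8 k h 5 = csig8_2 k ∧
    cRow8 k h 6 + cRow8 k h 7 = csig8_3 k ∧
    cRow8 k h 8 + cRow8 k h 9 = csig8_4 k := by
  simp [cRow8]
  omega

/-- … and of a pivot column. -/
theorem cCol8_val (k : Fin 10) (g : ℕ × ℕ × ℕ) (hb : g.1 ≤ 1 - csig8_2 k ∧ g.2.1 ≤ 1 - csig8_3 k ∧ g.2.2 ≤ 1 - csig8_4 k) :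
    cCol8 k g 4 = g.1 ∧
    cCol8 k g 6 = g.2.1 ∧
    cCol8 k g 8 = g.2.2 ∧
    cCol8 k g 0 = 0 ∧
    cCol8 k g 2 = 0 ∧
    csig8_0 k + (cCol8 k g 0 + cCol8 k g 1) = 1 ∧
    csig8_1 k + (cCol8 k g 2 + cCol8 k g 3) = 1 ∧
    csig8_2 k + (cCol8 k g 4 + cCol8 k g 5) = 1 ∧
    csig8_3 k + (cCol8 k g 6 + cCol8 k g 7) = 1 ∧
    csig8_4 k + (cCol8 k g 8 + cCol8 k g 9) = 1 := by
  obtain ⟨l0, l1, l2, l3, l4⟩ := csig_le8 k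
  simp [cCol8]
  omega

variable {L Ψ modeK off}

/-- ℓ(m) < r_{shape(m)}. -/
theorem cmodeL_lt8 (H1 : ∀ m : Fin r, off (modeK m) ≤ m.1 ∧ m.1 < off (modeK m) + crs8 Ψ (modeK m)) (m : Fin r) :
    m.1 - off (modeK m) < crs8 Ψ (modeK m) := by
  have := H1 m
  omega

/-- the box facts of the pivots of mode m. -/
theorem cpivot_box8 (hV : Ψ.valid L = true) (H1 : ∀ m : Fin r, off (modeK m) ≤ m.1 ∧ m.1 < off (modeK m) + crs8 Ψ (modeK m)) (m : Fin r) :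
    ((Ψ.rowP (csig8_2 (modeK m)) (csig8_3 (modeK m)) (csig8_4 (modeK m)) (m.1 - off (modeK m))).1 ≤ csig8_2 (modeK m) ∧ (Ψ.rowP (csig8_2 (modeK m)) (csig8_3 (modeK m)) (csig8_4 (modeK m)) (m.1 - off (modeK m))).2.1 ≤ csig8_3 (modeK m) ∧ (Ψ.rowP (csig8_2 (modeK m)) (csig8_3 (modeK m)) (csig8_4 (modeK m)) (m.1 - off (modeK m))).2.2 ≤ csig8_4 (modeK m)) ∧
    ((Ψ.colP (csig8_2 (modeK m)) (csig8_3 (modeK m)) (csig8_4 (modeK m)) (m.1 - off (modeK m))).1 ≤ 1 - csig8_2 (modeK m) ∧ (Ψ.colP (csig8_2 (modeK m)) (csig8_3 (modeK m)) (csig8_4 (modeK m)) (m.1 - off (modeK m))).2.1 ≤ 1 - csig8_3 (modeK m) ∧ (Ψ.colP (csig8_2 (modeK m)) (csig8_3 (modeK m)) (csig8_4 (modeK m)) (m.1 - off (modeK m))).2.2 ≤ 1 - csig8_4 (modeK m)) := by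
  obtain ⟨l0, l1, l2, l3, l4⟩ := csig_le8 (modeK m)
  obtain ⟨-, -, hb⟩ := CubicCert.pivots hV (by omega) (by omega) (by omega) (cmodeL_lt8 H1 m)
  exact ⟨⟨hb.1, hb.2.1, hb.2.2.1⟩, hb.2.2.2⟩

/-- the pivot row of mode m … -/
def crho8 (hV : Ψ.valid L = true) (H1 : ∀ m : Fin r, off (modeK m) ≤ m.1 ∧ m.1 < off (modeK m) + crs8 Ψ (modeK m)) (m : Fin r) :
    indexSet 8 3 (8 / 2 * 3 - 8 - 2) :=
  ⟨cRow8 (modeK m) (Ψ.rowP (csig8_2 (modeK m)) (csig8_3 (modeK m)) (csig8_4 (modeK m)) (m.1 - off (modeK m))), cRow8_mem _ _ (cpivot_box8 hV H1 m).1⟩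

/-- … and its pivot column. -/
def cgam8 (hV : Ψ.valid L = true) (H1 : ∀ m : Fin r, off (modeK m) ≤ m.1 ∧ m.1 < off (modeK m) + crs8 Ψ (modeK m)) (m : Fin r) :
    indexSet 8 3 3 :=
  ⟨cCol8 (modeK m) (Ψ.colP (csig8_2 (modeK m)) (csig8_3 (modeK m)) (csig8_4 (modeK m)) (m.1 - off (modeK m))), cCol8_mem _ _ (cpivot_box8 hV H1 m).2⟩

/-- heads, tails and pair sums of ρ(m) … -/
theorem crho8_val (hV : Ψ.valid L = true) (H1 : ∀ m : Fin r, off (modeK m) ≤ m.1 ∧ m.1 < off (modeK m) + crs8 Ψ (modeK m)) (m : Fin r) :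
    (crho8 hV H1 m).1 4 = (Ψ.rowP (csig8_2 (modeK m)) (csig8_3 (modeK m)) (csig8_4 (modeK m)) (m.1 - off (modeK m))).1 ∧
    (crho8 hV H1 m).1 6 = (Ψ.rowP (csig8_2 (modeK m)) (csig8_3 (modeK m)) (csig8_4 (modeK m)) (m.1 - off (modeK m))).2.1 ∧
    (crho8 hV H1 m).1 8 = (Ψ.rowP (csig8_2 (modeK m)) (csig8_3 (modeK m)) (csig8_4 (modeK m)) (m.1 - off (modeK m))).2.2 ∧
    (crho8 hV H1 m).1 0 = 0 ∧
    (crho8 hV H1 m).1 2 = 0 ∧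
    (crho8 hV H1 m).1 0 + (crho8 hV H1 m).1 1 = csig8_0 (modeK m) ∧
    (crho8 hV H1 m).1 2 + (crho8 hV H1 m).1 3 = csig8_1 (modeK m) ∧
    (crho8 hV H1 m).1 4 + (crho8 hV H1 m).1 5 = csig8_2 (modeK m) ∧
    (crho8 hV H1 m).1 6 + (crho8 hV H1 m).1 7 = csig8_3 (modeK m) ∧
    (crho8 hV H1 m).1 8 + (crho8 hV H1 m).1 9 = csig8_4 (modeK m) :=
  cRow8_val (modeK m) _ (cpivot_box8 hV H1 m).1

/-- … and of γ(m). -/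
theorem cgam8_val (hV : Ψ.valid L = true) (H1 : ∀ m : Fin r, off (modeK m) ≤ m.1 ∧ m.1 < off (modeK m) + crs8 Ψ (modeK m)) (m : Fin r) :
    (cgam8 hV H1 m).1 4 = (Ψ.colP (csig8_2 (modeK m)) (csig8_3 (modeK m)) (csig8_4 (modeK m)) (m.1 - off (modeK m))).1 ∧
    (cgam8 hV H1 m).1 6 = (Ψ.colP (csig8_2 (modeK m)) (csig8_3 (modeK m)) (csig8_4 (modeK m)) (m.1 - off (modeK m))).2.1 ∧
    (cgam8 hV H1 m).1 8 = (Ψ.colP (csig8_2 (modeK m)) (csig8_3 (modeK m)) (csig8_4 (modeK m)) (m.1 - off (modeK m))).2.2 ∧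
    (cgam8 hV H1 m).1 0 = 0 ∧
    (cgam8 hV H1 m).1 2 = 0 ∧
    csig8_0 (modeK m) + ((cgam8 hV H1 m).1 0 + (cgam8 hV H1 m).1 1) = 1 ∧
    csig8_1 (modeK m) + ((cgam8 hV H1 m).1 2 + (cgam8 hV H1 m).1 3) = 1 ∧
    csig8_2 (modeK m) + ((cgam8 hV H1 m).1 4 + (cgam8 hV H1 m).1 5) = 1 ∧
    csig8_3 (modeK m) + ((cgam8 hV H1 m).1 6 + (cgam8 hV H1 m).1 7) = 1 ∧
    csig8_4 (modeK m) + ((cgam8 hV H1 m).1 8 + (cgam8 hV H1 m).1 9) = 1 :=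
  cCol8_val (modeK m) _ (cpivot_box8 hV H1 m).2

/-- U on a pivot row: supported on the modes of the same type, with value ζ⁰ · A_shape[h_{ℓ(m)}, ℓ(m')]. -/
theorem CU8_rho (hV : Ψ.valid L = true) (H1 : ∀ m : Fin r, off (modeK m) ≤ m.1 ∧ m.1 < off (modeK m) + crs8 Ψ (modeK m)) (m m' : Fin r) :
    CU8 ζ Ψ modeK off (crho8 hV H1 m) m' = if modeK m' = modeK m then
      ζ ^ (0 + 0) * Z6.eval ζ (Ψ.A (csig8_2 (modeK m)) (csig8_3 (modeK m)) (csig8_4 (modeK m))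
        (Ψ.rowP (csig8_2 (modeK m)) (csig8_3 (modeK m)) (csig8_4 (modeK m)) (m.1 - off (modeK m))).1
        (Ψ.rowP (csig8_2 (modeK m)) (csig8_3 (modeK m)) (csig8_4 (modeK m)) (m.1 - off (modeK m))).2.1
        (Ψ.rowP (csig8_2 (modeK m)) (csig8_3 (modeK m)) (csig8_4 (modeK m)) (m.1 - off (modeK m))).2.2 (m'.1 - off (modeK m))) else 0 := by
  obtain ⟨ea, eb, ee, z0, z1, p0, p1, p2, p3, p4⟩ := crho8_val hV H1 m
  unfold CU8
  rw [p0, p1, p2, p3, p4, ea, eb, ee, z0, z1]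
  by_cases hk : modeK m' = modeK m
  · rw [if_pos hk, hk, if_pos ⟨rfl, rfl, rfl, rfl, rfl⟩]
  · rw [if_neg hk, if_neg]
    intro h
    exact hk (csig_inj8 _ _ h.1.symm h.2.1.symm h.2.2.1.symm h.2.2.2.1.symm h.2.2.2.2.symm)

/-- V on a pivot column: supported on the modes of the same type, with value ζ^{tails} · B_shape[ℓ(m), g_{ℓ(m')}]. -/
theorem CV8_gam (hV : Ψ.valid L = true) (H1 : ∀ m : Fin r, off (modeK m) ≤ m.1 ∧ m.1 < off (modeK m) + crs8 Ψ (modeK m)) (m m' : Fin r) :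
    CV8 ζ Ψ modeK off m (cgam8 hV H1 m') = if modeK m = modeK m' then
      ζ ^ (0 + 1 + (0 + 1)) * Z6.eval ζ (Ψ.B (csig8_2 (modeK m')) (csig8_3 (modeK m')) (csig8_4 (modeK m')) (m.1 - off (modeK m'))
        (Ψ.colP (csig8_2 (modeK m')) (csig8_3 (modeK m')) (csig8_4 (modeK m')) (m'.1 - off (modeK m'))).1
        (Ψ.colP (csig8_2 (modeK m')) (csig8_3 (modeK m')) (csig8_4 (modeK m')) (m'.1 - off (modeK m'))).2.1
        (Ψ.colP (csig8_2 (modeK m')) (csig8_3 (modeK m')) (csig8_4 (modeK m')) (m'.1 - off (modeK m'))).2.2) else 0 := by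
  obtain ⟨ea, eb, ee, z0, z1, p0, p1, p2, p3, p4⟩ := cgam8_val hV H1 m'
  unfold CV8
  by_cases hk : modeK m = modeK m'
  · rw [if_pos hk, hk, p0, p1, p2, p3, p4, ea, eb, ee, z0, z1, if_pos ⟨rfl, rfl, rfl, rfl, rfl⟩]
  · rw [if_neg hk, if_neg]
    intro h
    exact hk (csig_inj8 _ _ (by omega) (by omega) (by omega) (by omega) (by omega))

/-- LOWER BOUND: rank M_δ ≥ r. -/
theorem cle_rank_of_cert8 [CharZero K] (h2 : ζ ^ 2 = ζ - 1) (hV : Ψ.valid L = true)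
    (H1 : ∀ m : Fin r, off (modeK m) ≤ m.1 ∧ m.1 < off (modeK m) + crs8 Ψ (modeK m)) (H2 : ∀ k : Fin 10, off k + crs8 Ψ k ≤ r)
    (H3 : ∀ m : Fin r, ∀ k : Fin 10, off k ≤ m.1 → m.1 < off k + crs8 Ψ k → modeK m = k) :
    r ≤ (ivhsMatrix 8 3 ζ (cplaneList8 L)).rank := by
  classical
  have hz : ζ ≠ 0 := by
    rintro rfl
    norm_num at h2
  set M := ivhsMatrix 8 3 ζ (cplaneList8 L) with hM
  have hS : M.submatrix (crho8 hV H1) (cgam8 hV H1) =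
      (CU8 ζ Ψ modeK off).submatrix (crho8 hV H1) id * (CV8 ζ Ψ modeK off).submatrix id (cgam8 hV H1) := by
    rw [hM, ivhsMatrix_cplaneList8_eq_mul ζ L Ψ modeK off h2 hV H1 H2 H3]
    exact Matrix.submatrix_mul _ _ _ _ _ Function.bijective_id
  -- the left factor of the minor is lower triangular with nonzero diagonal
  have hUt : ((CU8 ζ Ψ modeK off).submatrix (crho8 hV H1) id).BlockTriangular OrderDual.toDual := by
    intro m m' hlt
    have hlt' : m < m' := OrderDual.toDual_lt_toDual.mp hlt
    rw [Matrix.submatrix_apply, id_eq, CU8_rho ζ hV H1]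
    by_cases hk : modeK m' = modeK m
    · rw [if_pos hk]
      obtain ⟨l0, l1, l2, l3, l4⟩ := csig_le8 (modeK m)
      obtain ⟨hℓ, hℓ'⟩ := PlaneSum.modeL_lt_of_lt modeK off (crs8 Ψ) H1 hlt' hk
      rw [CubicCert.A_upper_zero hV (by omega) (by omega) (by omega) (cmodeL_lt8 H1 m) hℓ' hℓ, Z6.zero_def, Z6.eval_zero, mul_zero]
    · rw [if_neg hk]
  have hUd : ∀ m : Fin r, ((CU8 ζ Ψ modeK off).submatrix (crho8 hV H1) id) m m ≠ 0 := by
    intro m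
    rw [Matrix.submatrix_apply, id_eq, CU8_rho ζ hV H1, if_pos rfl]
    obtain ⟨l0, l1, l2, l3, l4⟩ := csig_le8 (modeK m)
    exact mul_ne_zero (pow_ne_zero _ hz) (Z6.eval_ne_zero_of_posConst ζ (CubicCert.pivots hV (by omega) (by omega) (by omega) (cmodeL_lt8 H1 m)).1)
  -- the right factor of the minor is upper triangular with nonzero diagonal
  have hVt : ((CV8 ζ Ψ modeK off).submatrix id (cgam8 hV H1)).BlockTriangular id := by
    intro m m' hlt
    have hlt' : m' < m := hlt
    rw [Matrix.submatrix_apply, id_eq, CV8_gam ζ hV H1]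
    by_cases hk : modeK m = modeK m'
    · rw [if_pos hk]
      obtain ⟨l0, l1, l2, l3, l4⟩ := csig_le8 (modeK m')
      obtain ⟨hℓ, hℓ'⟩ := PlaneSum.modeL_lt_of_lt modeK off (crs8 Ψ) H1 hlt' hk
      rw [CubicCert.B_lower_zero hV (by omega) (by omega) (by omega) (cmodeL_lt8 H1 m') hℓ' hℓ, Z6.zero_def, Z6.eval_zero, mul_zero]
    · rw [if_neg hk]
  have hVd : ∀ m : Fin r, ((CV8 ζ Ψ modeK off).submatrix id (cgam8 hV H1)) m m ≠ 0 := by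
    intro m
    rw [Matrix.submatrix_apply, id_eq, CV8_gam ζ hV H1, if_pos rfl]
    obtain ⟨l0, l1, l2, l3, l4⟩ := csig_le8 (modeK m)
    have hBw := Z6.eval_ne_zero_of_posConst ζ (CubicCert.pivots hV (by omega) (by omega) (by omega) (cmodeL_lt8 H1 m)).2.1
    rw [Z6.eval_mul ζ h2] at hBw
    exact mul_ne_zero (pow_ne_zero _ hz) (left_ne_zero_of_mul hBw)
  have hdet : IsUnit (M.submatrix (crho8 hV H1) (cgam8 hV H1)).det := by
    rw [hS, Matrix.det_mul, Matrix.det_of_lowerTriangular _ hUt, Matrix.det_of_upperTriangular hVt]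
    exact isUnit_iff_ne_zero.mpr (mul_ne_zero (Finset.prod_ne_zero_iff.mpr fun m _ => hUd m)
      (Finset.prod_ne_zero_iff.mpr fun m _ => hVd m))
  have hrank : (M.submatrix (crho8 hV H1) (cgam8 hV H1)).rank = r := by
    rw [Matrix.rank_of_isUnit _ ((Matrix.isUnit_iff_isUnit_det _).mpr hdet), Fintype.card_fin]
  calc r = (M.submatrix (crho8 hV H1) (cgam8 hV H1)).rank := hrank.symm
    _ ≤ M.rank := Matrix.rank_submatrix_le M _ _

/-- MAIN THEOREM (cubic, n = 8): a valid cubic core certificate with a mode enumeration decides the row `IvhsRankEq 8 3 r (cplaneList8 L)`. -/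
theorem ivhsRankEq3_of_cert8 (L : List (ℤ × ℕ × ℕ × ℕ)) (Ψ : CubicCert) (hV : Ψ.valid L = true) {r : ℕ} (modeK : Fin r → Fin 10)
    (off : Fin 10 → ℕ) (H1 : ∀ m : Fin r, off (modeK m) ≤ m.1 ∧ m.1 < off (modeK m) + crs8 Ψ (modeK m))
    (H2 : ∀ k : Fin 10, off k + crs8 Ψ k ≤ r) (H3 : ∀ m : Fin r, ∀ k : Fin 10, off k ≤ m.1 → m.1 < off k + crs8 Ψ k → modeK m = k) :
    IvhsRankEq 8 3 r (cplaneList8 L) := by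
  intro K _ _ ζ hζ
  have h2 : ζ ^ 2 = ζ - 1 := (primRoot6_facts ζ hζ).2.2
  exact le_antisymm (crank_le_of_cert8 ζ L Ψ modeK off h2 hV H1 H2 H3) (cle_rank_of_cert8 ζ h2 hV H1 H2 H3)

end cert

end Summit.HodgeConjecture.HodgeConjecture.HodgeLocus.Census.CubicSum
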